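import Mathlib
import Summits.Ventures.PercRepro2.TypedTwoEdgeOTwoSlot

/-!
# The two-edge `o` at `a₃`, IV: the class-`2` row (blind cell PercRepro2, mine-2 g53, 2026-08-29;
`conjectures/MINE-2.md` M2-111 add. 1)

For a mark `o` with exactly the two edges `g₁ = {o, v}` of class `2` and `g₂ = {o, a₃}` of class
`c₂`, with `M_j := N(g₁ := 3, g₂ := j)` the count with `o` contracted into `v` and the `o–a₃` edge
kept as `{v, a₃}` of class `j`:

  **`typedCount_two_edge_o_two`**: `N = [c₂ ≤ 1] · 2 M₀ + [c₂ ∈ {1, 2}] · M₁`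

(`N(2, 0) = 2 M₀`, `N(2, 1) = 2 M₀ + M₁`, `N(2, 2) = M₁`, `N(2, 3) = 0`).  The split at `g₁`
leaves three placements with two open copies each; the closed copy is inert, so each placement
is the sum of the two `o`-terms of its open copies, and each such term is, by the class-`2` slot
reduction (`TypedTwoEdgeOTwoSlot.lean`, after a copy permutation), `[c₂ ≤ 1]` times the `o`-term
on `M₀` plus `[c₂ ∈ {1, 2}]` times the `o`-term on the instance with `g₂` open in the OTHER open
copy (a bridge).  The six (`o`-copy, bridge copy) terms are exactly the six `o`-terms of `M₁`
(the split of `M₁` at `g₂`: the copy carrying `g₂` has no `o`-term), and the six `o`-terms on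
`M₀` are each `o`-term of `M₀` twice.  With `TypedTwoEdgeO.lean` (class `1`) the two-edge `o` at
`a₃` is a reducible configuration of row 2′TRI at every class pair
(**`typedCount_nonneg_of_two_edge_o_two`**).  Own work; standard axioms.
-/

namespace Summit.Ventures.PercRepro2

namespace CovForm

namespace TypedRed

open OneTyped

section Theorem

open Classical

variable {V : Type*} {E : Type*} [Fintype E] [DecidableEq E] {R : Type*} [Field R]
variable (ends : E → Sym2 V) (o a₁ a₂ a₃ b : V)

/-- A cyclic copy permutation. -/
lemma typedCount_cycle (F : Finset E) (z : Config E) (τ : E → ℕ)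
    (K : Config E → Config E → Config E → R) :
    typedCount F z τ (fun x y w => K y w x) = typedCount F z τ K := by
  have h1 := TypedA3.typedCount_swap12 F z τ (fun x y w => K x w y)
  have h2 := typedCount_swap23' F z τ K
  exact h1.trans h2

/-- The other cyclic copy permutation. -/
lemma typedCount_cycle' (F : Finset E) (z : Config E) (τ : E → ℕ)
    (K : Config E → Config E → Config E → R) :
    typedCount F z τ (fun x y w => K w x y) = typedCount F z τ K := by
  have h1 := typedCount_swap23' F z τ (fun x y w => K y x w)
  have h2 := TypedA3.typedCount_swap12 F z τ K
  exact h1.trans h2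

/-- **The two-edge `o` at `a₃`, class `2`**: with `g₁ = {o, v}` of class `2` and `g₂ = {o, a₃}` of
class `τ g₂`, the typed count of `K₃` is `[τ g₂ ≤ 1] · 2 · N(g₁ := 3, g₂ := 0) +
[τ g₂ ∈ {1, 2}] · N(g₁ := 3, g₂ := 1)`. -/
theorem typedCount_two_edge_o_two {g₁ g₂ : E} {v : V} (hg₁ : ends g₁ = s(o, v))
    (hg₂ : ends g₂ = s(o, a₃)) (hdeg : ∀ e, o ∈ ends e → e = g₁ ∨ e = g₂)
    (hov : o ≠ v) (ho1 : o ≠ a₁) (ho2 : o ≠ a₂) (ho3 : o ≠ a₃) (hob : o ≠ b) (hg12 : g₁ ≠ g₂)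
    (F : Finset E) (hg₁F : g₁ ∈ F) (hg₂F : g₂ ∈ F) (z : Config E) (τ : E → ℕ) (hτ : τ g₁ = 2) :
    typedCount F z τ (K3 ends o a₁ a₂ a₃ b : Config E → Config E → Config E → R) =
      (if τ g₂ ≤ 1 then (2 : R) else 0) *
        typedCount F z (Function.update (Function.update τ g₁ 3) g₂ 0) (K3 ends o a₁ a₂ a₃ b) +
      (if τ g₂ = 1 ∨ τ g₂ = 2 then (1 : R) else 0) *
        typedCount F z (Function.update (Function.update τ g₁ 3) g₂ 1) (K3 ends o a₁ a₂ a₃ b) := by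
  set S := st ends o a₁ a₂ a₃ b with hS
  have hg₂F' : g₂ ∈ F.erase g₁ := Finset.mem_erase.2 ⟨hg12.symm, hg₂F⟩
  have hg₁F' : g₁ ∉ F.erase g₁ := fun h => (Finset.mem_erase.1 h).1 rfl
  have hg₂F'' : g₂ ∉ (F.erase g₁).erase g₂ := fun h => (Finset.mem_erase.1 h).1 rfl
  set F'' := (F.erase g₁).erase g₂ with hF''
  set z'' := Function.update (Function.update z g₁ true) g₂ false with hz''
  set m₀ : R := if τ g₂ ≤ 1 then 1 else 0 with hm₀
  set m₁ : R := if τ g₂ = 1 ∨ τ g₂ = 2 then 1 else 0 with hm₁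
  have hinert : ∀ y : Config E,
      ((S (Function.update y g₁ false)).Lo = false ∧ (S (Function.update y g₁ false)).Ho = false) ∨
      ((S (Function.update y g₁ false)).Lo = (S (Function.update y g₁ false)).L3 ∧
        (S (Function.update y g₁ false)).Ho = (S (Function.update y g₁ false)).H3) :=
    fun y => st_oInert ends o a₁ a₂ a₃ b hg₁ hg₂ hdeg ho1 ho2 _
      (Or.inl (Function.update_self g₁ false y))
  have hcoinc : ∀ x : Config E,
      (S (Function.update x g₂ true)).Lo = (S (Function.update x g₂ true)).L3 ∧
        (S (Function.update x g₂ true)).Ho = (S (Function.update x g₂ true)).H3 :=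
    fun x => st_coinc_of_open ends o a₁ a₂ a₃ b hg₂ _ (Function.update_self g₂ true x)
  have hτ' : ∀ e ∈ F'', Function.update (Function.update τ g₁ 3) g₂ 0 e = τ e := fun e he => by
    rw [Function.update_of_ne (Finset.mem_erase.1 he).1,
      Function.update_of_ne (Finset.mem_erase.1 (Finset.mem_erase.1 he).2).1]
  have hτ1 : ∀ e ∈ F'', Function.update (Function.update τ g₁ 3) g₂ 1 e = τ e := fun e he => by
    rw [Function.update_of_ne (Finset.mem_erase.1 he).1,
      Function.update_of_ne (Finset.mem_erase.1 (Finset.mem_erase.1 he).2).1]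
  -- the `o`-terms on `M₀`
  set Qx : R := typedCount F'' z'' τ (fun x y w => ((KOx (S x) (S y) (S w) : ℤ) : R)) with hQx
  set Qy : R := typedCount F'' z'' τ (fun x y w => ((KOy (S x) (S y) (S w) : ℤ) : R)) with hQy
  set Qz : R := typedCount F'' z'' τ (fun x y w => ((KOz (S x) (S y) (S w) : ℤ) : R)) with hQz
  -- the `o`-terms on `M₁`, by (`o`-copy, bridge copy)
  set Pxy : R := typedCount F'' z'' τ
    (fun x y w => ((KOx (S x) (S (Function.update y g₂ true)) (S w) : ℤ) : R)) with hPxy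
  set Pxz : R := typedCount F'' z'' τ
    (fun x y w => ((KOx (S x) (S y) (S (Function.update w g₂ true)) : ℤ) : R)) with hPxz
  set Pyx : R := typedCount F'' z'' τ
    (fun x y w => ((KOy (S (Function.update x g₂ true)) (S y) (S w) : ℤ) : R)) with hPyx
  set Pyz : R := typedCount F'' z'' τ
    (fun x y w => ((KOy (S x) (S y) (S (Function.update w g₂ true)) : ℤ) : R)) with hPyz
  set Pzx : R := typedCount F'' z'' τ
    (fun x y w => ((KOz (S (Function.update x g₂ true)) (S y) (S w) : ℤ) : R)) with hPzx
  set Pzy : R := typedCount F'' z'' τ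
    (fun x y w => ((KOz (S x) (S (Function.update y g₂ true)) (S w) : ℤ) : R)) with hPzy
  -- `M₀`
  have hR0 : typedCount F z (Function.update (Function.update τ g₁ 3) g₂ 0)
      (K3 ends o a₁ a₂ a₃ b : Config E → Config E → Config E → R) = Qx + Qy + Qz := by
    rw [typedCount_type_three F g₁ hg₁F z _
        (by rw [Function.update_of_ne hg12, Function.update_self]),
      typedCount_type_zero (F.erase g₁) g₂ hg₂F' _ _ (Function.update_self g₂ 0 _),
      typedCount_congr_τ ((F.erase g₁).erase g₂) _ (τ' := τ) hτ', hQx, hQy, hQz,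
      ← typedCount_add, ← typedCount_add]
    refine typedCount_congr_K _ _ _ fun x y w => ?_
    rw [K3_eq_KB, ← hS, KB_eq_KOx_add]
    push_cast
    ring
  -- `M₁`: the split at `g₂`, the copy carrying `g₂` has no `o`-term
  have hsup : ∀ x : Config E, x g₂ = z'' g₂ → Function.update x g₂ false = x := by
    intro x hx
    refine Function.update_eq_self_iff.2 ?_
    rw [hx, hz'', Function.update_self]
  have hR1 : typedCount F z (Function.update (Function.update τ g₁ 3) g₂ 1)
      (K3 ends o a₁ a₂ a₃ b : Config E → Config E → Config E → R) =
      (Pyx + Pzx) + (Pxy + Pzy) + (Pxz + Pyz) := by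
    rw [typedCount_type_three F g₁ hg₁F z _
        (by rw [Function.update_of_ne hg12, Function.update_self]),
      typedCount_split (F.erase g₁) g₂ hg₂F', Function.update_self]
    simp only [Fintype.sum_bool, Bool.toNat_true, Bool.toNat_false]
    norm_num
    rw [typedCount_congr_τ _ _ (τ' := τ) hτ1, typedCount_congr_τ _ _ (τ' := τ) hτ1,
      typedCount_congr_τ _ _ (τ' := τ) hτ1]
    have t1 : typedCount F'' z'' τ (fun x y w => K3 ends o a₁ a₂ a₃ b (Function.update x g₂ true)
        (Function.update y g₂ false) (Function.update w g₂ false) :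
          Config E → Config E → Config E → R) = Pyx + Pzx := by
      rw [hPyx, hPzx, ← typedCount_add]
      refine typedCount_congr_K_on _ _ _ fun x y w hagree _ => ?_
      rw [hsup y (hagree g₂ hg₂F'').2.1, hsup w (hagree g₂ hg₂F'').2.2, K3_eq_KB, ← hS,
        KB_eq_KOx_add, KOx_eq_zero_of_oInert _ _ _ (Or.inr (hcoinc x))]
      push_cast
      ring
    have t2 : typedCount F'' z'' τ (fun x y w => K3 ends o a₁ a₂ a₃ b (Function.update x g₂ false)
        (Function.update y g₂ true) (Function.update w g₂ false) :
          Config E → Config E → Config E → R) = Pxy + Pzy := by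
      rw [hPxy, hPzy, ← typedCount_add]
      refine typedCount_congr_K_on _ _ _ fun x y w hagree _ => ?_
      rw [hsup x (hagree g₂ hg₂F'').1, hsup w (hagree g₂ hg₂F'').2.2, K3_eq_KB, ← hS,
        KB_eq_KOx_add, KOy_eq_zero_of_oInert _ _ _ (Or.inr (hcoinc y))]
      push_cast
      ring
    have t3 : typedCount F'' z'' τ (fun x y w => K3 ends o a₁ a₂ a₃ b (Function.update x g₂ false)
        (Function.update y g₂ false) (Function.update w g₂ true) :
          Config E → Config E → Config E → R) = Pxz + Pyz := by
      rw [hPxz, hPyz, ← typedCount_add]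
      refine typedCount_congr_K_on _ _ _ fun x y w hagree _ => ?_
      rw [hsup x (hagree g₂ hg₂F'').1, hsup y (hagree g₂ hg₂F'').2.1, K3_eq_KB, ← hS,
        KB_eq_KOx_add, KOz_eq_zero_of_oInert _ _ _ (Or.inr (hcoinc w))]
      push_cast
      ring
    rw [t1, t2, t3]
    ring
  -- the six (`o`-copy, other open copy) terms of the split at `g₁`
  have slot := typedCount_two_edge_o_slot_two (R := R) ends o a₁ a₂ a₃ b
  have Axy : typedCount (F.erase g₁) (Function.update z g₁ false) τ
      (fun x y w => ((KOx (S (Function.update x g₁ true)) (S (Function.update y g₁ true))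
        (S (Function.update w g₁ false)) : ℤ) : R)) = m₀ * Qx + m₁ * Pxy := by
    rw [slot KOx (fun x y w h1 h2 => KOx_eq_zero_of_oInert x y w (Or.inr ⟨h1, h2⟩)) KOx_killO_z
      hg₁ hg₂ hdeg hov ho1 ho2 ho3 hob hg12 (F.erase g₁) hg₁F' hg₂F' z τ]
  have Ayx : typedCount (F.erase g₁) (Function.update z g₁ false) τ
      (fun x y w => ((KOy (S (Function.update x g₁ true)) (S (Function.update y g₁ true))
        (S (Function.update w g₁ false)) : ℤ) : R)) = m₀ * Qy + m₁ * Pyx := by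
    have h1 : typedCount (F.erase g₁) (Function.update z g₁ false) τ
        (fun x y w => ((KOy (S (Function.update x g₁ true)) (S (Function.update y g₁ true))
          (S (Function.update w g₁ false)) : ℤ) : R)) =
        typedCount (F.erase g₁) (Function.update z g₁ false) τ
        (fun x y w => ((KOy (S (Function.update y g₁ true)) (S (Function.update x g₁ true))
          (S (Function.update w g₁ false)) : ℤ) : R)) :=
      TypedA3.typedCount_swap12 _ _ _ (fun x y w => ((KOy (S (Function.update y g₁ true)) (S (Function.update x g₁ true))
        (S (Function.update w g₁ false)) : ℤ) : R))
    have h2 : typedCount F'' z'' τ (fun x y w => ((KOy (S y) (S x) (S w) : ℤ) : R)) = Qy := by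
      rw [hQy]
      exact TypedA3.typedCount_swap12 F'' z'' τ (fun x y w => ((KOy (S x) (S y) (S w) : ℤ) : R))
    have h3 : typedCount F'' z'' τ
        (fun x y w => ((KOy (S (Function.update y g₂ true)) (S x) (S w) : ℤ) : R)) = Pyx := by
      rw [hPyx]
      exact TypedA3.typedCount_swap12 F'' z'' τ
        (fun x y w => ((KOy (S (Function.update x g₂ true)) (S y) (S w) : ℤ) : R))
    rw [h1, slot (fun x y w => KOy y x w)
      (fun x y w h1 h2 => KOy_eq_zero_of_oInert y x w (Or.inr ⟨h1, h2⟩))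
      (fun x y w => KOy_killO_z y x w) hg₁ hg₂ hdeg hov ho1 ho2 ho3 hob hg12 (F.erase g₁) hg₁F'
      hg₂F' z τ, h2, h3]
  have Axz : typedCount (F.erase g₁) (Function.update z g₁ false) τ
      (fun x y w => ((KOx (S (Function.update x g₁ true)) (S (Function.update y g₁ false))
        (S (Function.update w g₁ true)) : ℤ) : R)) = m₀ * Qx + m₁ * Pxz := by
    have h1 : typedCount (F.erase g₁) (Function.update z g₁ false) τ
        (fun x y w => ((KOx (S (Function.update x g₁ true)) (S (Function.update y g₁ false))
          (S (Function.update w g₁ true)) : ℤ) : R)) =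
        typedCount (F.erase g₁) (Function.update z g₁ false) τ
        (fun x y w => ((KOx (S (Function.update x g₁ true)) (S (Function.update w g₁ false))
          (S (Function.update y g₁ true)) : ℤ) : R)) :=
      typedCount_swap23' _ _ _ (fun x y w => ((KOx (S (Function.update x g₁ true)) (S (Function.update w g₁ false))
        (S (Function.update y g₁ true)) : ℤ) : R))
    have h2 : typedCount F'' z'' τ (fun x y w => ((KOx (S x) (S w) (S y) : ℤ) : R)) = Qx := by
      rw [hQx]
      exact typedCount_swap23' F'' z'' τ (fun x y w => ((KOx (S x) (S y) (S w) : ℤ) : R))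
    have h3 : typedCount F'' z'' τ
        (fun x y w => ((KOx (S x) (S w) (S (Function.update y g₂ true)) : ℤ) : R)) = Pxz := by
      rw [hPxz]
      exact typedCount_swap23' F'' z'' τ
        (fun x y w => ((KOx (S x) (S y) (S (Function.update w g₂ true)) : ℤ) : R))
    rw [h1, slot (fun x y w => KOx x w y)
      (fun x y w h1 h2 => KOx_eq_zero_of_oInert x w y (Or.inr ⟨h1, h2⟩))
      (fun x y w => KOx_killO_y x w y) hg₁ hg₂ hdeg hov ho1 ho2 ho3 hob hg12 (F.erase g₁) hg₁F'
      hg₂F' z τ, h2, h3]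
  have Azx : typedCount (F.erase g₁) (Function.update z g₁ false) τ
      (fun x y w => ((KOz (S (Function.update x g₁ true)) (S (Function.update y g₁ false))
        (S (Function.update w g₁ true)) : ℤ) : R)) = m₀ * Qz + m₁ * Pzx := by
    have h1 : typedCount (F.erase g₁) (Function.update z g₁ false) τ
        (fun x y w => ((KOz (S (Function.update x g₁ true)) (S (Function.update y g₁ false))
          (S (Function.update w g₁ true)) : ℤ) : R)) =
        typedCount (F.erase g₁) (Function.update z g₁ false) τ
        (fun x y w => ((KOz (S (Function.update y g₁ true)) (S (Function.update w g₁ false))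
          (S (Function.update x g₁ true)) : ℤ) : R)) :=
      typedCount_cycle' _ _ _ (fun x y w => ((KOz (S (Function.update y g₁ true)) (S (Function.update w g₁ false))
        (S (Function.update x g₁ true)) : ℤ) : R))
    have h2 : typedCount F'' z'' τ (fun x y w => ((KOz (S y) (S w) (S x) : ℤ) : R)) = Qz := by
      rw [hQz]
      exact typedCount_cycle F'' z'' τ (fun x y w => ((KOz (S x) (S y) (S w) : ℤ) : R))
    have h3 : typedCount F'' z'' τ
        (fun x y w => ((KOz (S (Function.update y g₂ true)) (S w) (S x) : ℤ) : R)) = Pzx := by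
      rw [hPzx]
      exact typedCount_cycle F'' z'' τ
        (fun x y w => ((KOz (S (Function.update x g₂ true)) (S y) (S w) : ℤ) : R))
    rw [h1, slot (fun x y w => KOz y w x)
      (fun x y w h1 h2 => KOz_eq_zero_of_oInert y w x (Or.inr ⟨h1, h2⟩))
      (fun x y w => KOz_killO_y y w x) hg₁ hg₂ hdeg hov ho1 ho2 ho3 hob hg12 (F.erase g₁) hg₁F'
      hg₂F' z τ, h2, h3]
  have Ayz : typedCount (F.erase g₁) (Function.update z g₁ false) τ
      (fun x y w => ((KOy (S (Function.update x g₁ false)) (S (Function.update y g₁ true))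
        (S (Function.update w g₁ true)) : ℤ) : R)) = m₀ * Qy + m₁ * Pyz := by
    have h1 : typedCount (F.erase g₁) (Function.update z g₁ false) τ
        (fun x y w => ((KOy (S (Function.update x g₁ false)) (S (Function.update y g₁ true))
          (S (Function.update w g₁ true)) : ℤ) : R)) =
        typedCount (F.erase g₁) (Function.update z g₁ false) τ
        (fun x y w => ((KOy (S (Function.update w g₁ false)) (S (Function.update x g₁ true))
          (S (Function.update y g₁ true)) : ℤ) : R)) :=
      typedCount_cycle _ _ _ (fun x y w => ((KOy (S (Function.update w g₁ false)) (S (Function.update x g₁ true))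
        (S (Function.update y g₁ true)) : ℤ) : R))
    have h2 : typedCount F'' z'' τ (fun x y w => ((KOy (S w) (S x) (S y) : ℤ) : R)) = Qy := by
      rw [hQy]
      exact typedCount_cycle' F'' z'' τ (fun x y w => ((KOy (S x) (S y) (S w) : ℤ) : R))
    have h3 : typedCount F'' z'' τ
        (fun x y w => ((KOy (S w) (S x) (S (Function.update y g₂ true)) : ℤ) : R)) = Pyz := by
      rw [hPyz]
      exact typedCount_cycle' F'' z'' τ
        (fun x y w => ((KOy (S x) (S y) (S (Function.update w g₂ true)) : ℤ) : R))
    rw [h1, slot (fun x y w => KOy w x y)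
      (fun x y w h1 h2 => KOy_eq_zero_of_oInert w x y (Or.inr ⟨h1, h2⟩))
      (fun x y w => KOy_killO_x w x y) hg₁ hg₂ hdeg hov ho1 ho2 ho3 hob hg12 (F.erase g₁) hg₁F'
      hg₂F' z τ, h2, h3]
  have Azy : typedCount (F.erase g₁) (Function.update z g₁ false) τ
      (fun x y w => ((KOz (S (Function.update x g₁ false)) (S (Function.update y g₁ true))
        (S (Function.update w g₁ true)) : ℤ) : R)) = m₀ * Qz + m₁ * Pzy := by
    have h1 : typedCount (F.erase g₁) (Function.update z g₁ false) τ
        (fun x y w => ((KOz (S (Function.update x g₁ false)) (S (Function.update y g₁ true))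
          (S (Function.update w g₁ true)) : ℤ) : R)) =
        typedCount (F.erase g₁) (Function.update z g₁ false) τ
        (fun x y w => ((KOz (S (Function.update w g₁ false)) (S (Function.update y g₁ true))
          (S (Function.update x g₁ true)) : ℤ) : R)) :=
      typedCount_swap13' _ _ _ (fun x y w => ((KOz (S (Function.update w g₁ false)) (S (Function.update y g₁ true))
        (S (Function.update x g₁ true)) : ℤ) : R))
    have h2 : typedCount F'' z'' τ (fun x y w => ((KOz (S w) (S y) (S x) : ℤ) : R)) = Qz := by
      rw [hQz]
      exact typedCount_swap13' F'' z'' τ (fun x y w => ((KOz (S x) (S y) (S w) : ℤ) : R))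
    have h3 : typedCount F'' z'' τ
        (fun x y w => ((KOz (S w) (S (Function.update y g₂ true)) (S x) : ℤ) : R)) = Pzy := by
      rw [hPzy]
      exact typedCount_swap13' F'' z'' τ
        (fun x y w => ((KOz (S x) (S (Function.update y g₂ true)) (S w) : ℤ) : R))
    rw [h1, slot (fun x y w => KOz w y x)
      (fun x y w h1 h2 => KOz_eq_zero_of_oInert w y x (Or.inr ⟨h1, h2⟩))
      (fun x y w => KOz_killO_x w y x) hg₁ hg₂ hdeg hov ho1 ho2 ho3 hob hg12 (F.erase g₁) hg₁F'
      hg₂F' z τ, h2, h3]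
  -- the three placements of `g₁`
  have hx : typedCount (F.erase g₁) (Function.update z g₁ false) τ
      (fun x y w => K3 ends o a₁ a₂ a₃ b (Function.update x g₁ true) (Function.update y g₁ true)
        (Function.update w g₁ false) : Config E → Config E → Config E → R) =
      (m₀ * Qx + m₁ * Pxy) + (m₀ * Qy + m₁ * Pyx) := by
    rw [← Axy, ← Ayx, ← typedCount_add]
    refine typedCount_congr_K _ _ _ fun x y w => ?_
    rw [K3_eq_KB, ← hS, KB_eq_KOx_add, KOz_eq_zero_of_oInert _ _ _ (hinert w)]
    push_cast
    ring
  have hy : typedCount (F.erase g₁) (Function.update z g₁ false) τ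
      (fun x y w => K3 ends o a₁ a₂ a₃ b (Function.update x g₁ true) (Function.update y g₁ false)
        (Function.update w g₁ true) : Config E → Config E → Config E → R) =
      (m₀ * Qx + m₁ * Pxz) + (m₀ * Qz + m₁ * Pzx) := by
    rw [← Axz, ← Azx, ← typedCount_add]
    refine typedCount_congr_K _ _ _ fun x y w => ?_
    rw [K3_eq_KB, ← hS, KB_eq_KOx_add, KOy_eq_zero_of_oInert _ _ _ (hinert y)]
    push_cast
    ring
  have hz : typedCount (F.erase g₁) (Function.update z g₁ false) τ
      (fun x y w => K3 ends o a₁ a₂ a₃ b (Function.update x g₁ false) (Function.update y g₁ true)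
        (Function.update w g₁ true) : Config E → Config E → Config E → R) =
      (m₀ * Qy + m₁ * Pyz) + (m₀ * Qz + m₁ * Pzy) := by
    rw [← Ayz, ← Azy, ← typedCount_add]
    refine typedCount_congr_K _ _ _ fun x y w => ?_
    rw [K3_eq_KB, ← hS, KB_eq_KOx_add, KOx_eq_zero_of_oInert _ _ _ (hinert x)]
    push_cast
    ring
  rw [typedCount_split F g₁ hg₁F z τ]
  simp only [Fintype.sum_bool, Bool.toNat_true, Bool.toNat_false, hτ]
  norm_num
  rw [hx, hy, hz, hR0, hR1, hm₀, hm₁]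
  split_ifs <;> ring

/-- **Row 2′TRI at a class-`2` two-edge `o` reduces to the contracted instances**: if the counts
with `o` contracted into `v` and the `o–a₃` edge removed (`M₀`) resp. of class `1` (`M₁`) are
nonnegative, so is the count with `g₁` of class `2`, whatever the class of `g₂`. -/
theorem typedCount_nonneg_of_two_edge_o_two [LinearOrder R] [IsStrictOrderedRing R]
    {g₁ g₂ : E} {v : V} (hg₁ : ends g₁ = s(o, v))
    (hg₂ : ends g₂ = s(o, a₃)) (hdeg : ∀ e, o ∈ ends e → e = g₁ ∨ e = g₂)
    (hov : o ≠ v) (ho1 : o ≠ a₁) (ho2 : o ≠ a₂) (ho3 : o ≠ a₃) (hob : o ≠ b) (hg12 : g₁ ≠ g₂)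
    (F : Finset E) (hg₁F : g₁ ∈ F) (hg₂F : g₂ ∈ F) (z : Config E) (τ : E → ℕ) (hτ : τ g₁ = 2)
    (h0 : 0 ≤ typedCount F z (Function.update (Function.update τ g₁ 3) g₂ 0)
      (K3 ends o a₁ a₂ a₃ b : Config E → Config E → Config E → R))
    (h1 : 0 ≤ typedCount F z (Function.update (Function.update τ g₁ 3) g₂ 1)
      (K3 ends o a₁ a₂ a₃ b : Config E → Config E → Config E → R)) :
    0 ≤ typedCount F z τ (K3 ends o a₁ a₂ a₃ b : Config E → Config E → Config E → R) := by
  rw [typedCount_two_edge_o_two ends o a₁ a₂ a₃ b hg₁ hg₂ hdeg hov ho1 ho2 ho3 hob hg12 F hg₁F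
    hg₂F z τ hτ]
  refine add_nonneg (mul_nonneg ?_ h0) (mul_nonneg ?_ h1) <;> split_ifs <;> norm_num

end Theorem

end TypedRed

end CovForm

end Summit.Ventures.PercRepro2
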